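import Literature.MathematicalPhysics.PowerSystems.DroopMicrogridFlatStateStability

/-!
# Droop-controlled microgrid with `Q–V` dynamics: the Hessian of the Hamiltonian is positive
# definite (modulo the rotation) for small angle differences across the lines — Shin–Zavala 2020
# Proposition 2, with an EXPLICIT angle threshold, and the stability corollary (Remark 5)

Topic `Literature/MathematicalPhysics/PowerSystems` (LADDER-GRIDFUSION rung G3.b; seat gridfusion-lit-2,
g14).  Model `DroopPH n` of `DroopMicrogridHamiltonian.lean` (Shin–Zavala (9) = Schiffer et al.
(21)–(22): `n` droop-controlled grid-forming inverters with first-order `P–ω` and `Q–V` dynamics on a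
Kron-reduced LOSSLESS network; state `x = (θ, ω̃, V)`; Hamiltonian (10) with Hessian blocks (15)
`L(x)`, `W(x)`, `T(x)`, `A`, `D(u)` = `hessL`, `hessW`, `hessT`, `hessA`, `hessD`; `(θ, V)`-block (36)
`hessThetaV x = [L W; Wᵀ D+T]`).  0 named facts, 0 sorry.

The companion files proved: an equilibrium whose Hessian is positive definite in a reference gauge
(`v_θ,i₀ = 0`; = the printed REDUCED Hessian positive definite) is locally exponentially stable modulo
the rotation (`DroopMicrogridHamiltonianStability.lean`, Schiffer et al. Prop. 5.9 / Shin–Zavala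
Prop. 1), and that this holds with nothing to check at FLAT states (`DroopMicrogridFlatStateStability`).
Shin–Zavala's PROPOSITION 2 is the perturbative extension of the flat case: positive definiteness
persists as long as the angle differences across the lines are small, uniformly on a voltage box.

> [ShinZavala2020, §IV-A p0006 L31–L45] «Observe that the Hessian is PD if and only if the Schur
> complement S(x,u) := L(x) − W(x)ᵀ(D(u) + T(x))⁻¹W(x) (16) is PD. We can see that L(x) is PD if
> θ ∈ Θ_G(π/2) but W(x)ᵀ(D(u) + T(x))⁻¹W(x) can make S(x,u) indefinite, where
> Θ_G(γ) := {θ ∈ ℝ^{n−1} | |θ_ij| < γ for {i,j} ∈ E} (17). …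
> PROPOSITION 2: Consider the port-Hamiltonian microgrid model (9) with Assumption 1. Suppose that
> Q^d_i + V^d_i/k_Qi > 0 and V_min < V_i < V_max for i ∈ V, then there exists ε ∈ ℝ_{>0} such that
> if θ ∈ Θ_G(ε), then ∇ₓₓH(x,u) > 0.»
> [L47–L49] «Proposition 2 indicates that, if the voltage angle differences between the neighboring
> nodes are sufficiently small, the Hessian is PD, and thus the Hamiltonian is strictly convex.»
> [Remark 5, L50–L53] «Proposition 2 reveals conditions under which an equilibrium of droop-controlled
> microgrid is guaranteed to be stable.»
> [Appendix B, p0010 L49–p0011 L3, proof] «∇ₓₓH(x,u) is PD if and only if D(u) + T(x) and its Schur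
> complement are PD … A is PD … D(u) is PD from the assumption that Q^d_i + V^d_i/k_Qi > 0 …
> T₁(x) is PSD … T₂(x) is PSD since it takes a weighted Laplacian form. Therefore, D(u) + T(x) is PD
> and its smallest eigenvalue is greater than or equal to the smallest eigenvalue of D(u) …
> λ_max(W(x)ᵀ(D(u) + T(x))⁻¹W(x)) ≤ ‖W(x)‖₁²/λ_min(D(u)) … ‖W(x)‖₁ ≤ 3B^max V^max |E| ε …
> L(x) ≥ λ_min(L_{π/4}) I (28) [if ε ≤ π/4] … S(x,u) ≥ [λ_min(L_{π/4}) − 9(B^max)²(V^max)²|E|²ε²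
> /λ_min(D(u))] I. … If ε is sufficiently small, then S(x,u) is PD and so is ∇ₓₓH(x,u).»
> Standing setting [§II p0003 L5–L9]: «The network is described as a connected, undirected,
> complex-weighted graph … The admittance matrix Y ∈ ℂ^{n×n} is defined as the weighted Laplacian of
> the graph» (zero row sums; Assumption 1(a): purely inductive, `G_ij = 0`).

## What is proved (full angle coordinates, reference gauge `u_{i₀} = 0` = the print's reduced space)

Write `y = (u, w)` for a `(θ, V)`-direction and `E(u) := Σ_iΣ_j B_ij (u_i − u_j)²` (twice the Dirichlet
energy of the susceptance graph).  Hypotheses on the network throughout: `B` symmetric, `B_ij ≥ 0`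
(`i ≠ j`), row sums `Σ_j B_ij ≤ 0` (the print's Laplacian admittance matrix has `= 0`; shunt
susceptance only helps), coupling graph of `B` connected; `Q^u_i ≥ q > 0`.
* §1 `hessW_transpose_mulVec_apply`: `(W(x)ᵀu)_j = Σ_i B_ij V_i sin θ_ij (u_i − u_j)`;
  `thetaVBlock_quadForm_eq`: `yᵀ(36)y = uᵀL(x)u + 2(W(x)ᵀu)·w + wᵀ(D + T(x))w`.
* §2 the proof's first half WITHOUT eigenvalues or inverses: `hessT_quadForm_nonneg'` (`T(x) ⪰ 0`,
  row sums `≤ 0`), `hessD_quadForm_ge` (`wᵀDw ≥ d‖w‖²` if `d ≤ Q^u_i/V_i²`), and the completed square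
  `thetaVBlock_quadForm_ge`: `yᵀ(36)y ≥ uᵀL(x)u − ‖W(x)ᵀu‖²/d` — the quadratic-form shadow of the
  Schur complement (16) with `(D + T)⁻¹ ⪯ d⁻¹I` (the print's (26)).
* §3 both remaining terms compared with the SAME graph energy `E(u)`: `hessL_quadForm_ge_energy`
  (`uᵀL(x)u ≥ ½V_min² c E(u)` when `V ≥ V_min ≥ 0` and `cos θ_ij ≥ c ≥ 0` on the lines) and
  `hessW_cross_sq_le_energy` (`‖W(x)ᵀu‖² ≤ s²V_max² β E(u)` when `|sin θ_ij| ≤ s` on the lines,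
  `0 ≤ V ≤ V_max`, `Σ_{i≠j} B_ij ≤ β`; weighted Cauchy–Schwarz per row).  DEVIATION from the print,
  which bounds the cross term by `‖W‖₁²/λ_min(D)·‖u‖²` and `L(x)` below by `λ_min(L_{π/4})‖u‖²`: comparing
  both with `E(u)` instead of `‖u‖²` removes the algebraic connectivity `λ_min(L_{π/4})` from the
  threshold — connectivity is used only qualitatively (`E(u) = 0 ⇒ u` constant).
* §4 **`thetaVBlock_pos_of_smallAngle`** (CERTIFICATE FORM of Prop. 2): if
  `2 s² V_max⁴ β < q V_min² c`, then at EVERY state with `V_min ≤ V_i ≤ V_max`, `cos θ_ij ≥ c` and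
  `|sin θ_ij| ≤ s` on the lines, the block (36) is positive definite on `{y ≠ 0, u_{i₀} = 0}`;
  **`hessian_pos_of_smallAngle`**: the same for the full Hessian `∇ₓₓH(x)` (15) (`A ≻ 0` splits off)
  — one scalar inequality in the data `(q, V_min, V_max, β, c, s)`, no matrix computation.
* §5 **`exists_smallAngle_hessian_pos`** (PROPOSITION 2 AS PRINTED): for `Q^u > 0` and `V_min > 0`
  there is `ε > 0` (explicit in the proof: `ε = min(π/3, K/(K + 2V_max⁴β))`, `K = ½ q V_min²`,
  `q = min_i Q^u_i`, `β = max_j Σ_{i≠j} B_ij`) such that at every state with `V_min ≤ V ≤ V_max` and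
  `|θ_i − θ_j| ≤ ε` across every line the Hessian (15) is positive definite in every reference gauge.
* §6 the stability corollary of Remark 5, BY NAME through the companion's
  `expStable_modRotation_of_thetaVBlock_posDef`: **`expStable_modRotation_of_smallAngle`**
  (certificate form: an equilibrium `x*` passing the scalar test is locally exponentially stable
  modulo the rotation) and **`exists_smallAngle_expStable`** (∃ `ε > 0` depending only on the data and
  the voltage box such that EVERY equilibrium with `V* ∈ [V_min, V_max]` and line angle differences
  `≤ ε` is locally exponentially stable modulo the rotation).

THREE COLUMNS / NOT CLAIMED.  MODELLED: the statements are about the model `DroopPH` (lossless,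
Kron-reduced, first-order filters, constant inputs).  CERTIFIED use: §4/§6 reduce the Hessian test at
an exactly known or interval-enclosed operating point to ONE inequality between rationals (with
rational lower/upper bounds `c ≤ cos`, `|sin| ≤ s` on the enclosure).  Not claimed: the print's
constants (`3B^maxV^max|E|ε`, `λ_min(L_{π/4})`) — replaced by the `E(u)`-comparison above; strict
convexity of `H` as a function (only positive definiteness of (15) modulo the rotation is typed; `H` is
rotation-invariant at equilibria, companion `H_add_constMode`); necessity of small angles (Remark 5's
converse is heuristic in the print too); anything about lossy networks or loads.

## References

* S. Shin, V. M. Zavala, *Computing economic-optimal and stable equilibria for droop-controlled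
  microgrids*, arXiv:2002.09802 (2020): §II p0003 L5–L9 (connected graph, Laplacian admittance
  matrix), §IV-A eqs. (15)–(17), Proposition 2 and Remark 5 p0006 L25–L62, Appendix B (proof of
  Proposition 2) p0010 L49–p0011 L3. [ShinZavala2020]
* J. Schiffer, R. Ortega, A. Astolfi, J. Raisch, T. Sezi, *Conditions for stability of
  droop-controlled inverter-based microgrids*, Automatica 50 (2014) 2457–2469: §5.3 Lemma 5.8,
  Proposition 5.9 with (31), (35)–(36) (held text p0012 L7–L57). [SchifferEtAl2014]

AI-produced formalisation (LADDER-GRIDFUSION seat gridfusion-lit-2 g14, 2026-08-28).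
-/

noncomputable section

open Set Filter Topology Finset Metric Real
open scoped Matrix BigOperators

namespace Literature.MathematicalPhysics.PowerSystems

namespace DroopPH

variable {n : ℕ} (M : DroopPH n)

/-! ## §1 The cross block `W(x)ᵀ` acts through angle DIFFERENCES; the block quadratic form -/

/-- **`(W(x)ᵀu)_j = Σ_i B_ij V_i sin(θ_i − θ_j)(u_i − u_j)`** for symmetric `B`: the `θ–V` cross block
of (15) sees only the differences of the angle direction `u` (consistent with `𝟙ᵀW(x) = 0`,
companion `const_vecMul_hessW`). [cite: ShinZavala2020, §IV-A eq. (15) (block `W(x)`)] -/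
theorem hessW_transpose_mulVec_apply (hB : ∀ i j, M.B i j = M.B j i) (x : State n)
    (u : Fin n → ℝ) (j : Fin n) :
    ((M.hessW x)ᵀ *ᵥ u) j = ∑ i, M.B i j * x.2.2 i * sin (x.1 i - x.1 j) * (u i - u j) := by
  have h1 : ((M.hessW x)ᵀ *ᵥ u) j
      = (∑ k, M.B j k * x.2.2 k * sin (x.1 j - x.1 k)) * u j
        + ∑ i, M.B i j * x.2.2 i * sin (x.1 i - x.1 j) * u i := by
    rw [Matrix.mulVec_transpose]
    simp only [Matrix.vecMul, dotProduct, hessW, Matrix.add_apply, Matrix.diagonal_apply,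
      Matrix.of_apply, mul_add, Finset.sum_add_distrib]
    congr 1
    · rw [Finset.sum_eq_single j (fun i _ hij => by rw [if_neg hij, mul_zero])
        (fun h => (h (Finset.mem_univ j)).elim), if_pos rfl, mul_comm]
    · exact Finset.sum_congr rfl fun i _ => by ring
  have h2 : (∑ k, M.B j k * x.2.2 k * sin (x.1 j - x.1 k)) * u j
      = -∑ i, M.B i j * x.2.2 i * sin (x.1 i - x.1 j) * u j := by
    rw [Finset.sum_mul, ← Finset.sum_neg_distrib]
    refine Finset.sum_congr rfl fun k _ => ?_
    rw [hB j k, show x.1 j - x.1 k = -(x.1 k - x.1 j) by ring, Real.sin_neg]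
    ring
  rw [h1, h2, ← sub_eq_neg_add, ← Finset.sum_sub_distrib]
  exact Finset.sum_congr rfl fun i _ => by ring

/-- **The quadratic form of the `(θ, V)`-block (36)**: with `u = y_θ`, `w = y_V`,
`yᵀ [L W; Wᵀ D+T] y = uᵀL(x)u + 2 (W(x)ᵀu)·w + wᵀ(D(u) + T(x))w`.
[cite: SchifferEtAl2014, proof of Proposition 5.9, (35)–(36); ShinZavala2020, eqs. (15)–(16)] -/
theorem thetaVBlock_quadForm_eq (x : State n) (y : Fin n ⊕ Fin n → ℝ) :
    y ⬝ᵥ (M.hessThetaV x *ᵥ y)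
      = (fun i => y (Sum.inl i)) ⬝ᵥ (M.hessL x *ᵥ fun i => y (Sum.inl i))
        + 2 * (((M.hessW x)ᵀ *ᵥ fun i => y (Sum.inl i)) ⬝ᵥ fun i => y (Sum.inr i))
        + (fun i => y (Sum.inr i)) ⬝ᵥ ((M.hessD x + M.hessT x) *ᵥ fun i => y (Sum.inr i)) := by
  set u : Fin n → ℝ := fun i => y (Sum.inl i) with hu
  set w : Fin n → ℝ := fun i => y (Sum.inr i) with hw
  have hy : y = Sum.elim u w := by
    ext (i | i) <;> rfl
  conv_lhs => rw [hy]
  rw [hessThetaV, Matrix.fromBlocks_mulVec, Sum.elim_comp_inl, Sum.elim_comp_inr,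
    sumElim_dotProduct_sumElim, dotProduct_add, dotProduct_add]
  have h1 : u ⬝ᵥ (M.hessW x *ᵥ w) = ((M.hessW x)ᵀ *ᵥ u) ⬝ᵥ w := by
    rw [Matrix.dotProduct_mulVec, Matrix.mulVec_transpose]
  have h2 : w ⬝ᵥ ((M.hessW x)ᵀ *ᵥ u) = ((M.hessW x)ᵀ *ᵥ u) ⬝ᵥ w := dotProduct_comm _ _
  rw [h1, h2]
  ring

/-! ## §2 `D(u) + T(x) ⪰ d·I` and the completed square: a lower bound for (36) without inverses -/

/-- **`T(x) ⪰ 0` at every state** for a dominantly inductive network (`B` symmetric, `B_ij ≥ 0` for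
`i ≠ j`, row sums `Σ_j B_ij ≤ 0`): `wᵀT(x)w = −Σ_iΣ_j B_ij cos θ_ij w_iw_j ≥ 0` (companion
`cosForm_nonpos`).  The companion's `hessT_quadForm_nonneg` assumed zero row sums (no shunts).
[cite: ShinZavala2020, Appendix B, proof of Proposition 2 («T₁(x) is PSD … T₂(x) is PSD»)] -/
theorem hessT_quadForm_nonneg' (hB : ∀ i j, M.B i j = M.B j i)
    (hBoff : ∀ i j, i ≠ j → 0 ≤ M.B i j) (hBrow : ∀ i, ∑ j, M.B i j ≤ 0) (x : State n)
    (w : Fin n → ℝ) : 0 ≤ w ⬝ᵥ (M.hessT x *ᵥ w) := by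
  have e : w ⬝ᵥ (M.hessT x *ᵥ w) = -∑ i, ∑ j, M.B i j * cos (x.1 i - x.1 j) * w i * w j := by
    simp only [dotProduct, Matrix.mulVec, hessT, Matrix.of_apply, Finset.mul_sum,
      ← Finset.sum_neg_distrib]
    refine Finset.sum_congr rfl fun i _ => Finset.sum_congr rfl fun j _ => ?_
    ring
  rw [e, neg_nonneg]
  exact M.cosForm_nonpos hB hBoff hBrow x.1 w

/-- **`wᵀD(u)w ≥ d‖w‖²`** whenever `d ≤ Q^u_i/V_i²` for all `i` (`D = diag(Q^u_i/V_i²)`, (15b)); the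
print's «smallest eigenvalue of D(u)». [cite: ShinZavala2020, eq. (15b) and Appendix B (26)] -/
theorem hessD_quadForm_ge (x : State n) {d : ℝ} (hd : ∀ i, d ≤ M.Qu i / x.2.2 i ^ 2)
    (w : Fin n → ℝ) : d * (w ⬝ᵥ w) ≤ w ⬝ᵥ (M.hessD x *ᵥ w) := by
  simp only [hessD, Matrix.mulVec_diagonal, dotProduct, Finset.mul_sum]
  exact Finset.sum_le_sum fun i _ => by nlinarith [hd i, sq_nonneg (w i)]

omit M in
/-- Completing the square: `2a·w + d‖w‖² ≥ −‖a‖²/d` for `d > 0` (`0 ≤ Σ_i (d w_i + a_i)²/d`). [folklore] -/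
private theorem cross_add_sq_ge {d : ℝ} (hd : 0 < d) (a w : Fin n → ℝ) :
    -(1 / d) * (a ⬝ᵥ a) ≤ 2 * (a ⬝ᵥ w) + d * (w ⬝ᵥ w) := by
  have h : 0 ≤ ∑ i, (d * w i + a i) ^ 2 / d :=
    Finset.sum_nonneg fun i _ => div_nonneg (sq_nonneg _) hd.le
  have e : ∑ i, (d * w i + a i) ^ 2 / d
      = 2 * (a ⬝ᵥ w) + d * (w ⬝ᵥ w) + (1 / d) * (a ⬝ᵥ a) := by
    simp only [dotProduct, Finset.mul_sum, ← Finset.sum_add_distrib]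
    refine Finset.sum_congr rfl fun i _ => ?_
    field_simp
    ring
  linarith

/-- **The block (36) bounded below through the Schur-complement road, with `(D + T(x))⁻¹ ⪯ d⁻¹I`**:
for `B` symmetric, `B_ij ≥ 0`, row sums `≤ 0`, and `0 < d ≤ Q^u_i/V_i²` for all `i`,
`yᵀ(36)y ≥ uᵀL(x)u − ‖W(x)ᵀu‖²/d` (`u = y_θ`) — since `wᵀ(D + T)w ≥ d‖w‖²` and
`2(Wᵀu)·w + d‖w‖² ≥ −‖Wᵀu‖²/d`.  This is the quadratic-form content of «the Hessian is PD iff the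
Schur complement (16) is PD» together with (26) `λ_max((D + T)⁻¹) ≤ 1/λ_min(D)`.
[cite: ShinZavala2020, §IV-A eq. (16) and Appendix B (26)] -/
theorem thetaVBlock_quadForm_ge (hB : ∀ i j, M.B i j = M.B j i)
    (hBoff : ∀ i j, i ≠ j → 0 ≤ M.B i j) (hBrow : ∀ i, ∑ j, M.B i j ≤ 0) (x : State n)
    {d : ℝ} (hd : 0 < d) (hdD : ∀ i, d ≤ M.Qu i / x.2.2 i ^ 2) (y : Fin n ⊕ Fin n → ℝ) :
    (fun i => y (Sum.inl i)) ⬝ᵥ (M.hessL x *ᵥ fun i => y (Sum.inl i))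
        - 1 / d * (((M.hessW x)ᵀ *ᵥ fun i => y (Sum.inl i))
            ⬝ᵥ ((M.hessW x)ᵀ *ᵥ fun i => y (Sum.inl i)))
      ≤ y ⬝ᵥ (M.hessThetaV x *ᵥ y) := by
  rw [M.thetaVBlock_quadForm_eq x y]
  set u : Fin n → ℝ := fun i => y (Sum.inl i)
  set w : Fin n → ℝ := fun i => y (Sum.inr i)
  set a : Fin n → ℝ := (M.hessW x)ᵀ *ᵥ u
  have hT := M.hessT_quadForm_nonneg' hB hBoff hBrow x w
  have hD := M.hessD_quadForm_ge x hdD w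
  have hsq := cross_add_sq_ge hd a w
  rw [Matrix.add_mulVec, dotProduct_add]
  nlinarith

/-! ## §3 Both remaining terms against the graph energy `E(u) = Σ_iΣ_j B_ij (u_i − u_j)²` -/

/-- **`uᵀL(x)u ≥ ½ V_min² c · Σ_iΣ_j B_ij (u_i − u_j)²`** when `V_i ≥ V_min ≥ 0` and
`cos(θ_i − θ_j) ≥ c ≥ 0` across every line (`i ≠ j`, `B_ij > 0`): the weighted Laplacian `L(x)`
(weights `B_ij V_iV_j cos θ_ij`, companion `hessL_quadForm`) dominates the susceptance Laplacian.
The print's (28) `L(x) ≥ λ_min(L_{π/4})I` for `ε ≤ π/4` is this comparison followed by an eigenvalue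
bound; the eigenvalue is not needed below. [cite: ShinZavala2020, Appendix B (28)] -/
theorem hessL_quadForm_ge_energy (hB : ∀ i j, M.B i j = M.B j i)
    (hBoff : ∀ i j, i ≠ j → 0 ≤ M.B i j) (x : State n) {Vmin c : ℝ} (hVmin : 0 ≤ Vmin)
    (hc : 0 ≤ c) (hV : ∀ i, Vmin ≤ x.2.2 i)
    (hcos : ∀ i j, i ≠ j → 0 < M.B i j → c ≤ cos (x.1 i - x.1 j)) (u : Fin n → ℝ) :
    1 / 2 * (Vmin ^ 2 * c) * ∑ i, ∑ j, M.B i j * (u i - u j) ^ 2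
      ≤ u ⬝ᵥ (M.hessL x *ᵥ u) := by
  rw [M.hessL_quadForm hB x u, mul_assoc]
  refine mul_le_mul_of_nonneg_left ?_ (by norm_num)
  rw [Finset.mul_sum]
  refine Finset.sum_le_sum fun i _ => ?_
  rw [Finset.mul_sum]
  refine Finset.sum_le_sum fun j _ => ?_
  by_cases hij : i = j
  · subst hij
    simp
  rcases (hBoff i j hij).eq_or_lt with h0 | hpos
  · rw [← h0]
    simp
  have hVV : Vmin ^ 2 ≤ x.2.2 i * x.2.2 j := by
    rw [sq]
    exact mul_le_mul (hV i) (hV j) hVmin ((hVmin.trans (hV i)))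
  have hcc := hcos i j hij hpos
  have hprod : Vmin ^ 2 * c ≤ x.2.2 i * x.2.2 j * cos (x.1 i - x.1 j) :=
    mul_le_mul hVV hcc hc ((sq_nonneg Vmin).trans hVV)
  have := mul_le_mul_of_nonneg_left hprod (mul_nonneg hpos.le (sq_nonneg (u i - u j)))
  nlinarith [this]

/-- The line susceptances at node `j` sum to at most the self-susceptance magnitude:
`Σ_{i ≠ j} B_ij ≤ −B_jj` (symmetric `B`, row sums `≤ 0`) — so `β := max_j (−B_jj)` is an admissible
bound in `hessW_cross_sq_le_energy` / `thetaVBlock_pos_of_smallAngle`. [cite: ShinZavala2020, §II (Laplacian admittance matrix) and Appendix B («−B_ii = Σ_{k∈N(i)} B_ik»)] -/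
theorem lineSum_le_neg_diag (hB : ∀ i j, M.B i j = M.B j i) (hBrow : ∀ i, ∑ j, M.B i j ≤ 0)
    (j : Fin n) : ∑ i ∈ Finset.univ.erase j, M.B i j ≤ -M.B j j := by
  have h := hBrow j
  rw [← Finset.add_sum_erase _ _ (Finset.mem_univ j)] at h
  have e : ∑ i ∈ Finset.univ.erase j, M.B i j = ∑ i ∈ Finset.univ.erase j, M.B j i :=
    Finset.sum_congr rfl fun i _ => hB i j
  linarith

/-- **`‖W(x)ᵀu‖² ≤ s² V_max² β · Σ_iΣ_j B_ij (u_i − u_j)²`** when `|sin(θ_i − θ_j)| ≤ s` across every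
line, `0 ≤ V_i ≤ V_max`, `B_ij ≥ 0` (`i ≠ j`) and `Σ_{i≠j} B_ij ≤ β` for every `j`: by §1,
`|(Wᵀu)_j| ≤ sV_max Σ_{i≠j} B_ij|u_i − u_j|`, and the weighted Cauchy–Schwarz inequality per row.
(The print bounds `λ_max(Wᵀ(D + T)⁻¹W)` by `‖W‖₁²/λ_min(D)` with `‖W(x)‖₁ ≤ 3B^maxV^max|E|ε`;
comparing with the graph energy instead of `‖u‖²` is what lets §4 dispense with `λ_min(L_{π/4})`.)
[cite: ShinZavala2020, Appendix B (27)] -/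
theorem hessW_cross_sq_le_energy (hB : ∀ i j, M.B i j = M.B j i)
    (hBoff : ∀ i j, i ≠ j → 0 ≤ M.B i j) (x : State n) {Vmax s β : ℝ}
    (hV0 : ∀ i, 0 ≤ x.2.2 i) (hV : ∀ i, x.2.2 i ≤ Vmax)
    (hsin : ∀ i j, i ≠ j → 0 < M.B i j → |sin (x.1 i - x.1 j)| ≤ s)
    (hβ : ∀ j, ∑ i ∈ Finset.univ.erase j, M.B i j ≤ β) (u : Fin n → ℝ) :
    ((M.hessW x)ᵀ *ᵥ u) ⬝ᵥ ((M.hessW x)ᵀ *ᵥ u)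
      ≤ s ^ 2 * Vmax ^ 2 * β * ∑ i, ∑ j, M.B i j * (u i - u j) ^ 2 := by
  classical
  -- per-row bound
  have hrow : ∀ j, ((M.hessW x)ᵀ *ᵥ u) j ^ 2
      ≤ s ^ 2 * Vmax ^ 2 * β * ∑ i, M.B i j * (u i - u j) ^ 2 := by
    intro j
    rw [M.hessW_transpose_mulVec_apply hB x u j]
    -- drop the vanishing diagonal term and pass to `Finset.univ.erase j`
    have hsplit : ∑ i, M.B i j * x.2.2 i * sin (x.1 i - x.1 j) * (u i - u j)
        = ∑ i ∈ Finset.univ.erase j, M.B i j * x.2.2 i * sin (x.1 i - x.1 j) * (u i - u j) := by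
      rw [← Finset.add_sum_erase _ _ (Finset.mem_univ j)]
      simp only [sub_self, Real.sin_zero, mul_zero, zero_add]
    have hsplit2 : ∑ i, M.B i j * (u i - u j) ^ 2
        = ∑ i ∈ Finset.univ.erase j, M.B i j * (u i - u j) ^ 2 := by
      rw [← Finset.add_sum_erase _ _ (Finset.mem_univ j), sub_self]
      ring
    rw [hsplit, hsplit2]
    -- |Σ t_i| ≤ Σ |t_i| ≤ s Vmax Σ B_ij |u_i - u_j|
    have habs : |∑ i ∈ Finset.univ.erase j, M.B i j * x.2.2 i * sin (x.1 i - x.1 j) * (u i - u j)|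
        ≤ s * Vmax * ∑ i ∈ Finset.univ.erase j, M.B i j * |u i - u j| := by
      refine (Finset.abs_sum_le_sum_abs _ _).trans ?_
      rw [Finset.mul_sum]
      refine Finset.sum_le_sum fun i hi => ?_
      have hij : i ≠ j := Finset.ne_of_mem_erase hi
      rcases (hBoff i j hij).eq_or_lt with h0 | hpos
      · rw [← h0]
        simp
      have hs := hsin i j hij hpos
      have hs0 : 0 ≤ s := (abs_nonneg _).trans hs
      have hVmax : 0 ≤ Vmax := (hV0 i).trans (hV i)
      rw [abs_mul, abs_mul, abs_mul, abs_of_pos hpos, abs_of_nonneg (hV0 i)]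
      have h1 : M.B i j * x.2.2 i * |sin (x.1 i - x.1 j)| * |u i - u j|
          ≤ M.B i j * Vmax * s * |u i - u j| := by
        have := mul_le_mul (hV i) hs (abs_nonneg _) hVmax
        have := mul_le_mul_of_nonneg_left this hpos.le
        have := mul_le_mul_of_nonneg_right this (abs_nonneg (u i - u j))
        nlinarith [this]
      nlinarith [h1]
    -- weighted Cauchy–Schwarz: (Σ B|Δ|)² ≤ (Σ B)(Σ BΔ²)
    have hCS : (∑ i ∈ Finset.univ.erase j, M.B i j * |u i - u j|) ^ 2
        ≤ (∑ i ∈ Finset.univ.erase j, M.B i j) * ∑ i ∈ Finset.univ.erase j, M.B i j * (u i - u j) ^ 2 :=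
      Finset.sum_sq_le_sum_mul_sum_of_sq_le_mul _
        (fun i hi => hBoff i j (Finset.ne_of_mem_erase hi))
        (fun i hi => mul_nonneg (hBoff i j (Finset.ne_of_mem_erase hi)) (sq_nonneg _))
        (fun i hi => by rw [mul_pow, sq_abs]; nlinarith)
    have hE0 : 0 ≤ ∑ i ∈ Finset.univ.erase j, M.B i j * (u i - u j) ^ 2 :=
      Finset.sum_nonneg fun i hi => mul_nonneg (hBoff i j (Finset.ne_of_mem_erase hi)) (sq_nonneg _)
    have hB0 : 0 ≤ ∑ i ∈ Finset.univ.erase j, M.B i j :=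
      Finset.sum_nonneg fun i hi => hBoff i j (Finset.ne_of_mem_erase hi)
    have hsum0 : 0 ≤ ∑ i ∈ Finset.univ.erase j, M.B i j * |u i - u j| :=
      Finset.sum_nonneg fun i hi => mul_nonneg (hBoff i j (Finset.ne_of_mem_erase hi)) (abs_nonneg _)
    have hsq : (∑ i ∈ Finset.univ.erase j, M.B i j * x.2.2 i * sin (x.1 i - x.1 j) * (u i - u j)) ^ 2
        ≤ (s * Vmax * ∑ i ∈ Finset.univ.erase j, M.B i j * |u i - u j|) ^ 2 := by
      rw [← sq_abs (∑ i ∈ Finset.univ.erase j, _)]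
      exact pow_le_pow_left₀ (abs_nonneg _) habs 2
    calc (∑ i ∈ Finset.univ.erase j, M.B i j * x.2.2 i * sin (x.1 i - x.1 j) * (u i - u j)) ^ 2
        ≤ (s * Vmax) ^ 2 * (∑ i ∈ Finset.univ.erase j, M.B i j * |u i - u j|) ^ 2 := by
          rw [← mul_pow]; exact hsq
      _ ≤ (s * Vmax) ^ 2 * ((∑ i ∈ Finset.univ.erase j, M.B i j)
            * ∑ i ∈ Finset.univ.erase j, M.B i j * (u i - u j) ^ 2) :=
          mul_le_mul_of_nonneg_left hCS (sq_nonneg _)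
      _ ≤ (s * Vmax) ^ 2 * (β * ∑ i ∈ Finset.univ.erase j, M.B i j * (u i - u j) ^ 2) :=
          mul_le_mul_of_nonneg_left (mul_le_mul_of_nonneg_right (hβ j) hE0) (sq_nonneg _)
      _ = s ^ 2 * Vmax ^ 2 * β * ∑ i ∈ Finset.univ.erase j, M.B i j * (u i - u j) ^ 2 := by ring
  -- sum the rows; `Σ_j Σ_i B_ij (u_i - u_j)² = Σ_i Σ_j B_ij (u_i - u_j)²`
  have hsymE : ∑ j, ∑ i, M.B i j * (u i - u j) ^ 2 = ∑ i, ∑ j, M.B i j * (u i - u j) ^ 2 :=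
    Finset.sum_comm
  calc ((M.hessW x)ᵀ *ᵥ u) ⬝ᵥ ((M.hessW x)ᵀ *ᵥ u)
      = ∑ j, ((M.hessW x)ᵀ *ᵥ u) j ^ 2 := by
        simp only [dotProduct, sq]
    _ ≤ ∑ j, s ^ 2 * Vmax ^ 2 * β * ∑ i, M.B i j * (u i - u j) ^ 2 := Finset.sum_le_sum fun j _ => hrow j
    _ = s ^ 2 * Vmax ^ 2 * β * ∑ i, ∑ j, M.B i j * (u i - u j) ^ 2 := by
        rw [← Finset.mul_sum, hsymE]

/-- The graph energy is nonnegative (`B_ij ≥ 0` off the diagonal; the diagonal terms vanish) — the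
susceptance Laplacian is positive semidefinite. [cite: SchifferEtAl2014, Lemma 5.8 («L is a symmetric Laplacian matrix … positive semidefinite»); ShinZavala2020, Appendix B («PSD since it takes a weighted Laplacian form»)] -/
theorem energy_nonneg (hBoff : ∀ i j, i ≠ j → 0 ≤ M.B i j) (u : Fin n → ℝ) :
    0 ≤ ∑ i, ∑ j, M.B i j * (u i - u j) ^ 2 := by
  refine Finset.sum_nonneg fun i _ => Finset.sum_nonneg fun j _ => ?_
  by_cases hij : i = j
  · subst hij; simp
  · exact mul_nonneg (hBoff i j hij) (sq_nonneg _)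

/-- On a connected coupling graph the graph energy vanishes only on constant angle directions; in a
reference gauge (`u_{i₀} = 0`) only at `u = 0`. [cite: SchifferEtAl2014, Lemma 5.8 («L is a symmetric Laplacian matrix of a connected graph … Hence, L > 0»)] -/
theorem eq_zero_of_energy_eq_zero (hBoff : ∀ i j, i ≠ j → 0 ≤ M.B i j)
    (hconn : ClassicalModel.CouplingConnected M.B) {u : Fin n → ℝ} {i₀ : Fin n} (hu0 : u i₀ = 0)
    (hE : ∑ i, ∑ j, M.B i j * (u i - u j) ^ 2 = 0) : u = 0 := by
  have hterm : ∀ i j, 0 ≤ M.B i j * (u i - u j) ^ 2 := fun i j => by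
    by_cases hij : i = j
    · subst hij; simp
    · exact mul_nonneg (hBoff i j hij) (sq_nonneg _)
  have hzero : ∀ i j, M.B i j * (u i - u j) ^ 2 = 0 := by
    intro i j
    have hi := (Finset.sum_eq_zero_iff_of_nonneg fun i _ =>
      Finset.sum_nonneg fun j _ => hterm i j).1 hE i (Finset.mem_univ i)
    exact (Finset.sum_eq_zero_iff_of_nonneg fun j _ => hterm i j).1 hi j (Finset.mem_univ j)
  have hlines : ∀ i j, i ≠ j → 0 < M.B i j → u i - u j = (0 : Fin n → ℝ) i - (0 : Fin n → ℝ) j := by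
    intro i j _ hpos
    have h := hzero i j
    rcases mul_eq_zero.1 h with h | h
    · exact absurd h hpos.ne'
    · simpa [sub_eq_zero] using (pow_eq_zero_iff two_ne_zero).1 h
  obtain ⟨c, hc⟩ := ClassicalModel.exists_const_of_lineAngles_eq hconn hlines
  have hc0 : c = 0 := by have := hc i₀; rw [hu0] at this; simpa using this.symm
  funext i
  rw [hc i, hc0]
  simp

/-! ## §4 Proposition 2, CERTIFICATE FORM: one scalar inequality in the data -/

/-- **Shin–Zavala Prop. 2, certificate form for the `(θ, V)`-block (36).**  Network: `B` symmetric,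
`B_ij ≥ 0` (`i ≠ j`), row sums `Σ_j B_ij ≤ 0`, connected coupling graph, line sums `Σ_{i≠j}B_ij ≤ β`;
inputs `Q^u_i ≥ q > 0`; a state `x` with voltages `V_min ≤ V_i ≤ V_max` (`V_min > 0`) and, across
every line (`i ≠ j`, `B_ij > 0`), `cos(θ_i − θ_j) ≥ c` and `|sin(θ_i − θ_j)| ≤ s`.  If
`2 s² V_max⁴ β < q V_min² c`, then the block (36) at `x` is POSITIVE DEFINITE on the directions with
`y_θ,i₀ = 0` (reference node `i₀`) — Schiffer et al.'s condition (31)/(36) at `x`.  Proof = the print's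
Appendix B with the `E(u)`-comparison: `yᵀ(36)y ≥ uᵀLu − ‖Wᵀu‖²V_max²/q ≥ (½qV_min²c − s²V_max⁴β)/q · E(u)
> 0` for non-constant `u`, and `= wᵀ(D + T)w > 0` for `u = 0`, `w ≠ 0`.
[cite: ShinZavala2020, §IV-A Proposition 2 and Appendix B (proof); SchifferEtAl2014, Lemma 5.8, Proposition 5.9 (31)/(36)] -/
theorem thetaVBlock_pos_of_smallAngle (hB : ∀ i j, M.B i j = M.B j i)
    (hBoff : ∀ i j, i ≠ j → 0 ≤ M.B i j) (hBrow : ∀ i, ∑ j, M.B i j ≤ 0)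
    (hconn : ClassicalModel.CouplingConnected M.B) {q Vmin Vmax c s β : ℝ} (hq : 0 < q)
    (hQu : ∀ i, q ≤ M.Qu i) (hVmin : 0 < Vmin) (hβ : ∀ j, ∑ i ∈ Finset.univ.erase j, M.B i j ≤ β)
    (hcert : 2 * s ^ 2 * Vmax ^ 4 * β < q * Vmin ^ 2 * c)
    (x : State n) (hVlo : ∀ i, Vmin ≤ x.2.2 i) (hVhi : ∀ i, x.2.2 i ≤ Vmax)
    (hcos : ∀ i j, i ≠ j → 0 < M.B i j → c ≤ cos (x.1 i - x.1 j))
    (hsin : ∀ i j, i ≠ j → 0 < M.B i j → |sin (x.1 i - x.1 j)| ≤ s)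
    (i₀ : Fin n) (y : Fin n ⊕ Fin n → ℝ) (hy0 : y (Sum.inl i₀) = 0) (hy : y ≠ 0) :
    0 < y ⬝ᵥ (M.hessThetaV x *ᵥ y) := by
  set u : Fin n → ℝ := fun i => y (Sum.inl i) with hu
  set w : Fin n → ℝ := fun i => y (Sum.inr i) with hw
  have hVpos : ∀ i, 0 < x.2.2 i := fun i => hVmin.trans_le (hVlo i)
  have hQpos : ∀ i, 0 < M.Qu i := fun i => hq.trans_le (hQu i)
  have hVmax : 0 < Vmax := (hVpos i₀).trans_le (hVhi i₀)
  -- β ≥ 0, hence c > 0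
  have hβ0 : 0 ≤ β := (Finset.sum_nonneg fun i hi => hBoff i i₀ (Finset.ne_of_mem_erase hi)).trans (hβ i₀)
  have hc : 0 < c := by
    have h1 : 0 ≤ 2 * s ^ 2 * Vmax ^ 4 * β := by positivity
    have h2 : 0 < q * Vmin ^ 2 * c := h1.trans_lt hcert
    have h3 : 0 < q * Vmin ^ 2 := by positivity
    by_contra hc
    rw [not_lt] at hc
    nlinarith [mul_nonneg h3.le (neg_nonneg.2 hc)]
  -- `d = q / V_max²`
  set d : ℝ := q / Vmax ^ 2 with hd
  have hdpos : 0 < d := div_pos hq (pow_pos hVmax 2)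
  have hdD : ∀ i, d ≤ M.Qu i / x.2.2 i ^ 2 := by
    intro i
    have hVi2 : 0 < x.2.2 i ^ 2 := pow_pos (hVpos i) 2
    have hle : x.2.2 i ^ 2 ≤ Vmax ^ 2 := pow_le_pow_left₀ (hVpos i).le (hVhi i) 2
    calc d = q / Vmax ^ 2 := rfl
      _ ≤ q / x.2.2 i ^ 2 := div_le_div_of_nonneg_left hq.le hVi2 hle
      _ ≤ M.Qu i / x.2.2 i ^ 2 := div_le_div_of_nonneg_right (hQu i) hVi2.le
  have hge := M.thetaVBlock_quadForm_ge hB hBoff hBrow x hdpos hdD y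
  set E : ℝ := ∑ i, ∑ j, M.B i j * (u i - u j) ^ 2 with hE
  have hE0 : 0 ≤ E := M.energy_nonneg hBoff u
  have hL := M.hessL_quadForm_ge_energy hB hBoff x hVmin.le hc.le hVlo hcos u
  have hWsq := M.hessW_cross_sq_le_energy hB hBoff x (fun i => (hVpos i).le) hVhi hsin hβ u
  by_cases hEz : E = 0
  · -- `u = 0`: the block form is `wᵀ(D + T)w > 0`
    have hu0 : u = 0 := M.eq_zero_of_energy_eq_zero hBoff hconn (i₀ := i₀) hy0 hEz
    have hw0 : w ≠ 0 := by
      intro hw0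
      apply hy
      ext (i | i)
      · exact congrFun hu0 i
      · exact congrFun hw0 i
    rw [M.thetaVBlock_quadForm_eq x y]
    change u ⬝ᵥ (M.hessL x *ᵥ u) + 2 * (((M.hessW x)ᵀ *ᵥ u) ⬝ᵥ w)
      + w ⬝ᵥ ((M.hessD x + M.hessT x) *ᵥ w) > 0
    rw [hu0, Matrix.mulVec_zero, Matrix.mulVec_zero, zero_dotProduct, zero_dotProduct, mul_zero,
      zero_add, zero_add]
    exact M.hessDT_quadForm_pos hB hBoff hBrow hQpos x (fun i => (hVpos i).ne') hw0
  · have hEpos : 0 < E := lt_of_le_of_ne hE0 (Ne.symm hEz)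
    -- `‖Wᵀu‖²/d ≤ s² V_max⁴ β E / q`
    have h1 : 1 / d * (((M.hessW x)ᵀ *ᵥ u) ⬝ᵥ ((M.hessW x)ᵀ *ᵥ u))
        ≤ 1 / d * (s ^ 2 * Vmax ^ 2 * β * E) :=
      mul_le_mul_of_nonneg_left hWsq (by positivity)
    have h2 : 1 / d * (s ^ 2 * Vmax ^ 2 * β * E) = s ^ 2 * Vmax ^ 4 * β * E / q := by
      rw [hd, one_div_div]
      ring
    have hq0 : q ≠ 0 := hq.ne'
    have h3 : 1 / 2 * (Vmin ^ 2 * c) * E - s ^ 2 * Vmax ^ 4 * β * E / q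
        = (q * Vmin ^ 2 * c - 2 * s ^ 2 * Vmax ^ 4 * β) / (2 * q) * E := by
      field_simp
    have h4 : 0 < (q * Vmin ^ 2 * c - 2 * s ^ 2 * Vmax ^ 4 * β) / (2 * q) * E :=
      mul_pos (div_pos (by linarith) (by positivity)) hEpos
    have : (fun i => y (Sum.inl i)) = u := rfl
    rw [this] at hge
    linarith

/-- The `ω̃`-block `A` is positive SEMIdefinite as a quadratic form (companion `hessA_quadForm_pos`
gives `> 0` off `0`). [cite: ShinZavala2020, eq. (15a) («A is PD»)] -/
theorem hessA_quadForm_nonneg (hτP : ∀ i, 0 < M.τP i) (hkP : ∀ i, 0 < M.kP i) (w : Fin n → ℝ) :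
    0 ≤ w ⬝ᵥ (M.hessA *ᵥ w) := by
  by_cases hw : w = 0
  · rw [hw]; simp
  · exact (M.hessA_quadForm_pos hτP hkP hw).le

/-- **Shin–Zavala Prop. 2, certificate form for the full Hessian (15)**: under the hypotheses of
`thetaVBlock_pos_of_smallAngle` and positive `τ_P, k_P` (block `A ≻ 0`), `vᵀ∇ₓₓH(x)v > 0` for every
`v ≠ 0` with `v_θ,i₀ = 0` — the printed «∇ₓₓH(x,u) > 0» in the reduced coordinates, here in a
reference gauge of the full angle coordinates. [cite: ShinZavala2020, §IV-A Proposition 2, eq. (15), Appendix B] -/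
theorem hessian_pos_of_smallAngle (hB : ∀ i j, M.B i j = M.B j i)
    (hBoff : ∀ i j, i ≠ j → 0 ≤ M.B i j) (hBrow : ∀ i, ∑ j, M.B i j ≤ 0)
    (hconn : ClassicalModel.CouplingConnected M.B) (hkP : ∀ i, 0 < M.kP i) (hτP : ∀ i, 0 < M.τP i)
    {q Vmin Vmax c s β : ℝ} (hq : 0 < q) (hQu : ∀ i, q ≤ M.Qu i) (hVmin : 0 < Vmin)
    (hβ : ∀ j, ∑ i ∈ Finset.univ.erase j, M.B i j ≤ β)
    (hcert : 2 * s ^ 2 * Vmax ^ 4 * β < q * Vmin ^ 2 * c)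
    (x : State n) (hVlo : ∀ i, Vmin ≤ x.2.2 i) (hVhi : ∀ i, x.2.2 i ≤ Vmax)
    (hcos : ∀ i j, i ≠ j → 0 < M.B i j → c ≤ cos (x.1 i - x.1 j))
    (hsin : ∀ i j, i ≠ j → 0 < M.B i j → |sin (x.1 i - x.1 j)| ≤ s)
    (i₀ : Fin n) (v : State n) (hv0 : v.1 i₀ = 0) (hv : v ≠ 0) :
    0 < pair v (M.hessCLM x v) := by
  have hVpos : ∀ i, 0 < x.2.2 i := fun i => hVmin.trans_le (hVlo i)
  rw [M.pair_hessCLM_eq_blocks hB x (fun i => (hVpos i).ne') v]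
  have hA := M.hessA_quadForm_nonneg hτP hkP v.2.1
  by_cases hy : Sum.elim v.1 v.2.2 = 0
  · -- then `v_ω̃ ≠ 0` and the `A`-block is positive
    have hω : v.2.1 ≠ 0 := by
      intro hω
      apply hv
      have h1 : v.1 = 0 := funext fun i => by simpa using congrFun hy (Sum.inl i)
      have h3 : v.2.2 = 0 := funext fun i => by simpa using congrFun hy (Sum.inr i)
      exact Prod.ext h1 (Prod.ext hω h3)
    rw [hy, Matrix.mulVec_zero, dotProduct_zero, zero_add]
    exact M.hessA_quadForm_pos hτP hkP hω
  · have hblock := M.thetaVBlock_pos_of_smallAngle hB hBoff hBrow hconn hq hQu hVmin hβ hcert x hVlo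
      hVhi hcos hsin i₀ (Sum.elim v.1 v.2.2) (by simpa using hv0) hy
    linarith

/-! ## §5 Proposition 2 AS PRINTED: a uniform angle threshold `ε > 0` on a voltage box -/

omit M in
/-- `|θ| ≤ ε ≤ π/3` gives `cos θ ≥ 1/2` and `|sin θ| ≤ ε`. [folklore] -/
private theorem cos_ge_half_and_abs_sin_le {θ ε : ℝ} (hθ : |θ| ≤ ε) (hε : ε ≤ π / 3) :
    1 / 2 ≤ cos θ ∧ |sin θ| ≤ ε := by
  refine ⟨?_, (Real.abs_sin_le_abs).trans hθ⟩
  rw [← Real.cos_abs θ, ← Real.cos_pi_div_three]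
  exact Real.cos_le_cos_of_nonneg_of_le_pi (abs_nonneg θ)
    (by linarith [Real.pi_pos]) (hθ.trans hε)

/-- **Shin–Zavala 2020 PROPOSITION 2 (as printed, with the threshold explicit in the proof).**  For the
port-Hamiltonian droop microgrid (9) on a connected, dominantly inductive network (`B` symmetric,
`B_ij ≥ 0` for `i ≠ j`, row sums `≤ 0`, connected coupling graph), with `Q^u_i = Q^d_i + V^d_i/k_Qi > 0`,
positive `τ_P, k_P`, and a voltage box `0 < V_min ≤ V_i ≤ V_max`: THERE IS `ε > 0` such that at every
state `x = (θ, ω̃, V)` with `V` in the box and `|θ_i − θ_j| ≤ ε` across every line, the Hessian (15)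
of the Hamiltonian is positive definite in every reference gauge (`vᵀ∇ₓₓH(x)v > 0` for `v ≠ 0`,
`v_θ,i₀ = 0`; = «∇ₓₓH(x,u) > 0» for the print's reduced state).  The proof takes
`ε = min(π/3, K/(K + 2V_max⁴β))` with `K = ½(min_i Q^u_i)V_min²`, `β = max_j Σ_{i≠j} B_ij`, and applies
§4 with `c = cos(π/3) = ½`, `s = ε ≥ |sin θ_ij|`.
[cite: ShinZavala2020, §IV-A Proposition 2 («there exists ε ∈ ℝ_{>0} such that if θ ∈ Θ_G(ε), then ∇ₓₓH(x,u) > 0») and Appendix B; SchifferEtAl2014, Lemma 5.8] -/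
theorem exists_smallAngle_hessian_pos (hB : ∀ i j, M.B i j = M.B j i)
    (hBoff : ∀ i j, i ≠ j → 0 ≤ M.B i j) (hBrow : ∀ i, ∑ j, M.B i j ≤ 0)
    (hconn : ClassicalModel.CouplingConnected M.B) (hkP : ∀ i, 0 < M.kP i) (hτP : ∀ i, 0 < M.τP i)
    (hQu : ∀ i, 0 < M.Qu i) {Vmin : ℝ} (hVmin : 0 < Vmin) (Vmax : ℝ) :
    ∃ ε > 0, ∀ x : State n, (∀ i, Vmin ≤ x.2.2 i) → (∀ i, x.2.2 i ≤ Vmax) →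
      (∀ i j, i ≠ j → 0 < M.B i j → |x.1 i - x.1 j| ≤ ε) →
      ∀ (i₀ : Fin n) (v : State n), v.1 i₀ = 0 → v ≠ 0 → 0 < pair v (M.hessCLM x v) := by
  classical
  rcases isEmpty_or_nonempty (Fin n) with hn | hn
  · exact ⟨1, one_pos, fun x _ _ _ i₀ => (IsEmpty.false i₀).elim⟩
  -- data: q = min Q^u, β = max line sum
  set q : ℝ := Finset.univ.inf' Finset.univ_nonempty M.Qu with hqdef
  set β : ℝ := Finset.univ.sup' Finset.univ_nonempty
    (fun j => ∑ i ∈ Finset.univ.erase j, M.B i j) with hβdef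
  have hq : 0 < q := by
    obtain ⟨i, -, hi⟩ := Finset.exists_mem_eq_inf' Finset.univ_nonempty M.Qu
    rw [hqdef, hi]; exact hQu i
  have hQu' : ∀ i, q ≤ M.Qu i := fun i => Finset.inf'_le _ (Finset.mem_univ i)
  have hβ : ∀ j, ∑ i ∈ Finset.univ.erase j, M.B i j ≤ β := fun j =>
    Finset.le_sup' (fun j => ∑ i ∈ Finset.univ.erase j, M.B i j) (Finset.mem_univ j)
  obtain ⟨j₀⟩ := hn
  have hβ0 : 0 ≤ β :=
    (Finset.sum_nonneg fun i hi => hBoff i j₀ (Finset.ne_of_mem_erase hi)).trans (hβ j₀)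
  set K : ℝ := 1 / 2 * q * Vmin ^ 2 with hK
  have hKpos : 0 < K := by positivity
  set A : ℝ := 2 * Vmax ^ 4 * β with hA
  have hA0 : 0 ≤ A := by positivity
  set ε₁ : ℝ := K / (K + A) with hε₁
  have hε₁pos : 0 < ε₁ := div_pos hKpos (by positivity)
  have hε₁le : ε₁ ≤ 1 := (div_le_one (by positivity)).2 (by linarith)
  have hε₁A : ε₁ ^ 2 * A < K := by
    have h1 : ε₁ ^ 2 * A ≤ ε₁ * A := by
      have : ε₁ ^ 2 ≤ ε₁ := by nlinarith
      exact mul_le_mul_of_nonneg_right this hA0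
    have h2 : ε₁ * (K + A) = K := by rw [hε₁]; field_simp
    nlinarith [mul_pos hε₁pos hKpos]
  refine ⟨min (π / 3) ε₁, lt_min (by positivity) hε₁pos, ?_⟩
  intro x hVlo hVhi hθ i₀ v hv0 hv
  have hε0 : 0 ≤ min (π / 3) ε₁ := (lt_min (by positivity) hε₁pos).le
  -- the scalar certificate with `c = 1/2`, `s = ε`
  have hcert : 2 * (min (π / 3) ε₁) ^ 2 * Vmax ^ 4 * β < q * Vmin ^ 2 * (1 / 2) := by
    have h1 : (min (π / 3) ε₁) ^ 2 ≤ ε₁ ^ 2 := pow_le_pow_left₀ hε0 (min_le_right _ _) 2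
    have h2 : 2 * (min (π / 3) ε₁) ^ 2 * Vmax ^ 4 * β = (min (π / 3) ε₁) ^ 2 * A := by rw [hA]; ring
    have h3 : (min (π / 3) ε₁) ^ 2 * A ≤ ε₁ ^ 2 * A := mul_le_mul_of_nonneg_right h1 hA0
    rw [h2]
    linarith
  refine M.hessian_pos_of_smallAngle hB hBoff hBrow hconn hkP hτP hq hQu' hVmin hβ hcert x hVlo hVhi
    (fun i j hij hpos => (cos_ge_half_and_abs_sin_le (hθ i j hij hpos) (min_le_left _ _)).1)
    (fun i j hij hpos => (cos_ge_half_and_abs_sin_le (hθ i j hij hpos) (min_le_left _ _)).2)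
    i₀ v hv0 hv

/-! ## §6 Remark 5: every equilibrium in the small-angle region is locally exponentially stable
modulo the rotation -/

/-- **Stability certificate from one scalar inequality** (Shin–Zavala Remark 5 / Prop. 1–2 with
Schiffer et al. Prop. 5.9, BY NAME through `expStable_modRotation_of_thetaVBlock_posDef`): network as
in `thetaVBlock_pos_of_smallAngle`, positive gains and time constants, `Q^u_i ≥ q > 0`; an EQUILIBRIUM
`x*` of (9) with `V_min ≤ V*_i ≤ V_max` (`V_min > 0`), `cos θ*_ij ≥ c`, `|sin θ*_ij| ≤ s` across the
lines and `2 s² V_max⁴ β < q V_min² c` is locally exponentially stable modulo the rotation: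
∃ `ρ, k, λ > 0`, every solution on `[0, T]` from the `ρ`-ball satisfies
`‖X t − (x* + (c'𝟙, 0, 0))‖ ≤ k‖X 0 − x*‖e^{−λt}` for some `c'`.
[cite: ShinZavala2020, §IV-A Proposition 2 and Remark 5 («conditions under which an equilibrium of droop-controlled microgrid is guaranteed to be stable»), Proposition 1; SchifferEtAl2014, Proposition 5.9] -/
theorem expStable_modRotation_of_smallAngle (hB : ∀ i j, M.B i j = M.B j i)
    (hBoff : ∀ i j, i ≠ j → 0 ≤ M.B i j) (hBrow : ∀ i, ∑ j, M.B i j ≤ 0)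
    (hconn : ClassicalModel.CouplingConnected M.B)
    (hkP : ∀ i, 0 < M.kP i) (hτP : ∀ i, 0 < M.τP i) (hkQ : ∀ i, 0 < M.kQ i) (hτQ : ∀ i, 0 < M.τQ i)
    {q Vmin Vmax c s β : ℝ} (hq : 0 < q) (hQu : ∀ i, q ≤ M.Qu i) (hVmin : 0 < Vmin)
    (hβ : ∀ j, ∑ i ∈ Finset.univ.erase j, M.B i j ≤ β)
    (hcert : 2 * s ^ 2 * Vmax ^ 4 * β < q * Vmin ^ 2 * c)
    {xs : State n} (heq : M.field xs = 0) (hVlo : ∀ i, Vmin ≤ xs.2.2 i) (hVhi : ∀ i, xs.2.2 i ≤ Vmax)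
    (hcos : ∀ i j, i ≠ j → 0 < M.B i j → c ≤ cos (xs.1 i - xs.1 j))
    (hsin : ∀ i j, i ≠ j → 0 < M.B i j → |sin (xs.1 i - xs.1 j)| ≤ s) (i₀ : Fin n) :
    ∃ ρ > 0, ∃ k > 0, ∃ lam > 0, ∀ (X : ℝ → State n) (T : ℝ), M.IsSolutionOn X (Icc 0 T) →
      ‖X 0 - xs‖ < ρ → ∃ c' : ℝ, ∀ t ∈ Icc 0 T,
        ‖X t - (xs + ((fun _ => c', 0, 0) : State n))‖ ≤ k * ‖X 0 - xs‖ * Real.exp (-lam * t) :=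
  M.expStable_modRotation_of_thetaVBlock_posDef hB hkP hτP hkQ hτQ heq
    (fun i => hVmin.trans_le (hVlo i)) i₀ fun y hy0 hy =>
    M.thetaVBlock_pos_of_smallAngle hB hBoff hBrow hconn hq hQu hVmin hβ hcert xs hVlo hVhi hcos hsin
      i₀ y hy0 hy

/-- **All equilibria with small line angle differences are locally exponentially stable modulo the
rotation, with ONE threshold for the whole voltage box** (Shin–Zavala Prop. 2 + Remark 5 with Prop. 1 /
Schiffer et al. Prop. 5.9): connected dominantly inductive network, `Q^u > 0`, positive gains and time
constants, `0 < V_min`; there is `ε > 0` (that of `exists_smallAngle_hessian_pos`) such that every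
equilibrium `x*` of (9) with `V_min ≤ V* ≤ V_max` and `|θ*_i − θ*_j| ≤ ε` across every line is locally
exponentially stable modulo the rotation (conclusion of `expStable_modRotation_of_hessian`).
MODELLED: model `DroopPH`; «stable» = the rotation orbit of the model's equilibrium attracts a
`ρ`-ball exponentially; no claim about any microgrid.
[cite: ShinZavala2020, §IV-A Proposition 2, Remark 5, Proposition 1; SchifferEtAl2014, Proposition 5.9] -/
theorem exists_smallAngle_expStable (hB : ∀ i j, M.B i j = M.B j i)
    (hBoff : ∀ i j, i ≠ j → 0 ≤ M.B i j) (hBrow : ∀ i, ∑ j, M.B i j ≤ 0)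
    (hconn : ClassicalModel.CouplingConnected M.B)
    (hkP : ∀ i, 0 < M.kP i) (hτP : ∀ i, 0 < M.τP i) (hkQ : ∀ i, 0 < M.kQ i) (hτQ : ∀ i, 0 < M.τQ i)
    (hQu : ∀ i, 0 < M.Qu i) {Vmin : ℝ} (hVmin : 0 < Vmin) (Vmax : ℝ) :
    ∃ ε > 0, ∀ xs : State n, M.field xs = 0 → (∀ i, Vmin ≤ xs.2.2 i) → (∀ i, xs.2.2 i ≤ Vmax) →
      (∀ i j, i ≠ j → 0 < M.B i j → |xs.1 i - xs.1 j| ≤ ε) →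
      ∃ ρ > 0, ∃ k > 0, ∃ lam > 0, ∀ (X : ℝ → State n) (T : ℝ), M.IsSolutionOn X (Icc 0 T) →
        ‖X 0 - xs‖ < ρ → ∃ c' : ℝ, ∀ t ∈ Icc 0 T,
          ‖X t - (xs + ((fun _ => c', 0, 0) : State n))‖ ≤ k * ‖X 0 - xs‖ * Real.exp (-lam * t) := by
  obtain ⟨ε, hε, hpos⟩ := M.exists_smallAngle_hessian_pos hB hBoff hBrow hconn hkP hτP hQu hVmin Vmax
  refine ⟨ε, hε, fun xs heq hVlo hVhi hθ => ?_⟩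
  rcases isEmpty_or_nonempty (Fin n) with hn | ⟨⟨i₀⟩⟩
  · -- no inverters: the state space is a point
    haveI : Subsingleton (State n) := by
      haveI := hn; infer_instance
    refine ⟨1, one_pos, 1, one_pos, 1, one_pos, fun X T _ _ => ⟨0, fun t _ => ?_⟩⟩
    rw [Subsingleton.elim (X t - (xs + ((fun _ => (0 : ℝ), 0, 0) : State n))) 0, norm_zero]
    positivity
  · exact M.expStable_modRotation_of_reducedHessian_posDef hB hkP hτP hkQ hτQ heq
      (fun i => hVmin.trans_le (hVlo i)) i₀ fun v hv0 hv => hpos xs hVlo hVhi hθ i₀ v hv0 hv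

end DroopPH

end Literature.MathematicalPhysics.PowerSystems
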